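import Summits.QuantumFields.BalabanUV.T4Continuum.Spine.NE2.DeltaPrimeBondData

/-!
# T⁴ programme, spine node NE2 (U1a) — THE CONNECTION BINDER `RegularSites (Ad ∘ V)` FROM THE (3.35)/(3.36) LETTERS OF THE GAUGE FIELD `V` ITSELF,
# AND THE (3.26)-SHAPE RATE END WITH ONE REGULARITY BINDER (cell `pub-balaban-gaps`, seat ne2 gen 3, file 3)

Every NE2 rate END of the `Spine/NE2/` chain reads the connection through `R = Ad ∘ V` and displays `RegularSites L M (Ad ∘ V) α β β₂` (size / lattice-Lipschitz /
second-difference letters of the ADJOINT transporters), while `Spine/NE2/DeltaPrimeBondData.balaban326_rate_of_bondRegular` displays, for (3.10)'s `Δ′`, the same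
structure on the bond variables `V` themselves.  THIS FILE derives the former from the latter: **`regularSites_adjointField`** —
`RegularSites L M V α₁ β₁ β₂ → RegularSites L M (Ad ∘ V) (2α₁) (2β₁) (4(β₂ + β₁²))`.  The size and first-difference letters are the β cell's Lipschitz bound
`‖Ad g − Ad h‖ ≤ 2‖g − h‖` (`AdjointFieldInstance.norm_adRep_sub_adRep_le`); the SECOND-DIFFERENCE letter is new: for unitaries `V₁, …, V₄` with second difference
`s = V₁ − V₂ − V₃ + V₄`, the exact telescoping **`R_second_diff_eq`**
  `V₁XV₁⋆ − V₂XV₂⋆ − V₃XV₃⋆ + V₄XV₄⋆ = sXV₁⋆ + (V₃ − V₄)X(V₁ − V₃)⋆ + V₂Xs⋆ + (V₂ − V₄)X(V₃ − V₄)⋆`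
(second difference of `Ad` = second difference of `V` + products of first differences), read in components through the β cell's Parseval/Hilbert–Schmidt road
(`AdjointCarrierWiring.adMat_real_bound` pattern: **`adMat_second_diff_real_bound`**, **`norm_cpx_adMat_second_diff_le`**: `‖Ad V₁ − Ad V₂ − Ad V₃ + Ad V₄‖ ≤ 4δ` whenever
`‖s‖, ‖V₃ − V₄‖‖V₁ − V₃‖, ‖V₂ − V₄‖‖V₃ − V₄‖ ≤ δ`).  §4: the END **`balaban326_rate_of_regularGaugeField`** — print's (3.26)-shape rate END at `R = Ad V` whose ONLY
regularity binder is `hregV : RegularSites L M V α₁ β₁ β₂` (the (3.35)+(3.36) shapes ON THE DATA `V`), plus node NE3 BY NAME (`LocalRate` on `regClass₂ (Ad ∘ V)`) and the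
NE3-type field-strength consistency (Fc), `2α₁, 2β₁ ≤ η ≤ etaStar`, ONE threshold — the six plaquette-field bounds, `hV1`, (F0), (F1) AND `RegularSites (Ad ∘ V)` of the
earlier ENDs all DISCHARGED.
HONEST FRAMING (T4-DAG p. 1).  MODEL LEVEL (`V`, `e`, `c` DATA; hypothesis structures displayed; (3.35)/(3.36) are SHAPE locators — nothing printed is a hypothesis or a
conclusion); NOT asserted: that `V` is Bałaban's minimiser or is this regular in his gauge ([B9] (3.35)–(3.36), [Balaban1985RegularGauge]; node NE3 OPEN), the [B7]
averaging (residual r2), m = k layer uniformity; NE2 (U1a) NOT PROVED; spine PROVED 0/9 unchanged; NOT continuum YM / infinite volume / mass gap / Clay.  HONEST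
DEPENDENCY: continuum YM on T⁴ ⇐ BetaPertH ∧ nine spine estimates (0/9 proved); BetaPertH ⇐ (D1) ∧ (D4) ∧ CAP+tail; G-an2-4 gates asym, D1 and NE2/3/4.  No `sorry`, no `def`.
-/

noncomputable section

open scoped BigOperators ComplexConjugate Matrix

namespace Summit.QuantumFields.BalabanUV.T4Continuum.NE2.AdjointFieldRegularity

open scoped Kronecker Matrix.Norms.L2Operator
open Literature.MathematicalPhysics.QuantumFieldTheory.Balaban1983to89.B5Prop11Plancherel (Tor fine unitVec Cst)
open Literature.MathematicalPhysics.QuantumFieldTheory.Balaban1983to89.B5G183RateUnitTower (lev lev_neZero)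
open Literature.MathematicalPhysics.QuantumFieldTheory.Balaban1983to89.B9AdOrthogonal (R form R_eq_of_mem Rₗ Rₗ_apply parseval coord_map)
open Literature.MathematicalPhysics.QuantumFieldTheory.Balaban1983to89.T4EtaRateMin (LocalRate)
open Summit.QuantumFields.BalabanUV.T4Continuum
open Summit.QuantumFields.BalabanUV.T4Continuum.BalabanAveragedTowerUnit (idx Qlev one_le_lev' lev_succ')
open Summit.QuantumFields.BalabanUV.T4Continuum.BalabanAveragedTowerModes (par)
open Summit.QuantumFields.BalabanUV.T4Continuum.BlockPairingGeometry (tau)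
open Summit.QuantumFields.BalabanUV.T4Continuum.CovariantAveragingTower (TowerLimitRate)
open Summit.QuantumFields.BalabanUV.T4Continuum.CovariantBlockAveraging (QcovLev)
open Summit.QuantumFields.BalabanUV.T4Continuum.BackgroundResolventTower (Cpert)
open Summit.QuantumFields.BalabanUV.T4Continuum.KingPairingPlantedLaw (CJ)
open Summit.QuantumFields.BalabanUV.T4Continuum.NE2FromNE3 (bgReadings)
open Summit.QuantumFields.BalabanUV.T4Continuum.RegularBackgroundTower (RegularTransporters betaNE3 lev_pos)
open Summit.QuantumFields.BalabanUV.T4Continuum.HolonomyTowerRegular (RegularSites regClass₂ wT DqT)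
open Summit.QuantumFields.BalabanUV.T4Continuum.B13AvgCorrPlaquette (norm_tau_sub_le_of_reg)
open Summit.QuantumFields.BalabanUV.T4Continuum.B13AvgCorrPlaquetteSecond (norm_le_one_of_unitary)
open Summit.QuantumFields.BalabanUV.T4Continuum.GaugeTermScalarData (QuT)
open Summit.QuantumFields.BalabanUV.T4Continuum.RegularSiteTransporters (siteT)
open Summit.QuantumFields.BalabanUV.T4Continuum.NestedContourTransport (theta0)
open Summit.QuantumFields.BalabanUV.T4Continuum.GramPerturbationLaw (C2gram)
open Summit.QuantumFields.BalabanUV.T4Continuum.NE2BalabanGauge (liftR)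
open Summit.QuantumFields.BalabanUV.T4Continuum.NE2BalabanLayerSharp (kappaBs C2Bs)
open Summit.QuantumFields.BalabanUV.T4Continuum.NE2BalabanWiring (epsR CdeltaR)
open Summit.QuantumFields.BalabanUV.T4Continuum.NE2BalabanFinal (kappa4F C4F)
open Summit.QuantumFields.BalabanUV.T4Continuum.NE2BalabanThreshold (etaStar)
open Summit.QuantumFields.BalabanUV.T4Continuum.GaugeTermSandwichBound (projP)
open Summit.QuantumFields.BalabanUV.T4Continuum.GaugeTermLayer (Gop)
open Summit.QuantumFields.BalabanUV.Beta.AdjointCarrierWiring (adMat adMat_apply fro fro_nonneg fro_conjTranspose fro_add_le fro_mul_le form_self_eq_fro form_combination)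
open Summit.QuantumFields.BalabanUV.Beta.AdjointCarrierWiringEnd (CompFamily)
open Summit.QuantumFields.BalabanUV.Beta.ThinLoopHolonomy (cpxHom cpxHom_apply norm_le_of_mulVec_le)
open Summit.QuantumFields.BalabanUV.T4Continuum.NE2.AdjointFieldInstance (adRep adRep_apply norm_adRep_sub_one_le norm_adRep_sub_adRep_le dist1_unitaryGroup)
open Summit.QuantumFields.BalabanUV.T4Continuum.NE2.DeltaPrimeOperator
open Summit.QuantumFields.BalabanUV.T4Continuum.NE2.DictionaryB0 (principalB9)
open Summit.QuantumFields.BalabanUV.T4Continuum.NE2.DeltaPrimeSecondOrder (kappaDP CDP)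
open Summit.QuantumFields.BalabanUV.T4Continuum.NE2.DeltaPrimeFieldStrength (Fstr symL brkL)
open Summit.QuantumFields.BalabanUV.T4Continuum.NE2.DeltaPrimeBondData (second_diff_letter_of_reg balaban326_rate_of_bondRegular)

variable {n : Type} [Fintype n] [DecidableEq n] {d : ℕ} {ι : Type} [Fintype ι] [DecidableEq ι]

/-! ## §1 Hilbert–Schmidt bookkeeping: sandwiches and four-term sums -/

section Frobenius

/-- `fro (A X B) ≤ ‖A‖²‖B‖²·fro X` (`ℓ²`-operator norms of the outer factors). [folklore] -/
theorem fro_sandwich_le (A X B : Matrix n n ℂ) : fro (A * X * B) ≤ ‖A‖ ^ 2 * ‖B‖ ^ 2 * fro X := by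
  have h1 : fro (X * B) ≤ ‖B‖ ^ 2 * fro X := by
    rw [← fro_conjTranspose, Matrix.conjTranspose_mul]
    refine (fro_mul_le _ _).trans ?_
    rw [Matrix.l2_opNorm_conjTranspose, fro_conjTranspose]
  calc fro (A * X * B) = fro (A * (X * B)) := by rw [Matrix.mul_assoc]
    _ ≤ ‖A‖ ^ 2 * fro (X * B) := fro_mul_le _ _
    _ ≤ ‖A‖ ^ 2 * (‖B‖ ^ 2 * fro X) := mul_le_mul_of_nonneg_left h1 (sq_nonneg _)
    _ = ‖A‖ ^ 2 * ‖B‖ ^ 2 * fro X := by ring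

omit [DecidableEq n] in
/-- `fro (T₁ + T₂ + T₃ + T₄) ≤ 4·(fro T₁ + fro T₂ + fro T₃ + fro T₄)`. [folklore] -/
theorem fro_add₄_le (T₁ T₂ T₃ T₄ : Matrix n n ℂ) : fro (T₁ + T₂ + T₃ + T₄) ≤ 4 * (fro T₁ + fro T₂ + fro T₃ + fro T₄) := by
  rw [add_assoc]
  have h := fro_add_le (T₁ + T₂) (T₃ + T₄)
  have h12 := fro_add_le T₁ T₂
  have h34 := fro_add_le T₃ T₄
  linarith

end Frobenius

/-! ## §2 The second difference of `R(V)X = VXV⋆` over four unitaries -/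

section SecondDiff

variable {V₁ V₂ V₃ V₄ : Matrix n n ℂ}

/-- **TELESCOPING OF THE SECOND DIFFERENCE OF `Ad`**: with `s = V₁ − V₂ − V₃ + V₄` (unitaries),
`V₁XV₁⋆ − V₂XV₂⋆ − V₃XV₃⋆ + V₄XV₄⋆ = sXV₁⋆ + (V₃ − V₄)X(V₁ − V₃)⋆ + V₂Xs⋆ + (V₂ − V₄)X(V₃ − V₄)⋆`. [folklore] -/
theorem R_second_diff_eq (h₁ : V₁ ∈ Matrix.unitaryGroup n ℂ) (h₂ : V₂ ∈ Matrix.unitaryGroup n ℂ) (h₃ : V₃ ∈ Matrix.unitaryGroup n ℂ)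
    (h₄ : V₄ ∈ Matrix.unitaryGroup n ℂ) (X : Matrix n n ℂ) :
    R V₁ X - R V₂ X - R V₃ X + R V₄ X
      = (V₁ - V₂ - V₃ + V₄) * X * V₁ᴴ + (V₃ - V₄) * X * (V₁ - V₃)ᴴ + V₂ * X * (V₁ - V₂ - V₃ + V₄)ᴴ + (V₂ - V₄) * X * (V₃ - V₄)ᴴ := by
  rw [R_eq_of_mem h₁, R_eq_of_mem h₂, R_eq_of_mem h₃, R_eq_of_mem h₄]
  simp only [Matrix.star_eq_conjTranspose, Matrix.conjTranspose_add, Matrix.conjTranspose_sub]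
  noncomm_ring

/-- **HILBERT–SCHMIDT BOUND OF THE SECOND DIFFERENCE**: if `‖s‖ ≤ δ`, `‖V₃ − V₄‖·‖V₁ − V₃‖ ≤ δ`, `‖V₂ − V₄‖·‖V₃ − V₄‖ ≤ δ` then
`fro (V₁XV₁⋆ − V₂XV₂⋆ − V₃XV₃⋆ + V₄XV₄⋆) ≤ 16δ²·fro X`. [folklore] -/
theorem fro_R_second_diff_le (h₁ : V₁ ∈ Matrix.unitaryGroup n ℂ) (h₂ : V₂ ∈ Matrix.unitaryGroup n ℂ) (h₃ : V₃ ∈ Matrix.unitaryGroup n ℂ)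
    (h₄ : V₄ ∈ Matrix.unitaryGroup n ℂ) {δ : ℝ} (hs : ‖V₁ - V₂ - V₃ + V₄‖ ≤ δ) (h13 : ‖V₃ - V₄‖ * ‖V₁ - V₃‖ ≤ δ) (h24 : ‖V₂ - V₄‖ * ‖V₃ - V₄‖ ≤ δ)
    (X : Matrix n n ℂ) : fro (R V₁ X - R V₂ X - R V₃ X + R V₄ X) ≤ 16 * δ ^ 2 * fro X := by
  have hδ : 0 ≤ δ := (norm_nonneg _).trans hs
  have hX := fro_nonneg X
  have hV₁ : ‖V₁ᴴ‖ ≤ 1 := by rw [Matrix.l2_opNorm_conjTranspose]; exact norm_le_one_of_unitary h₁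
  have hV₂ : ‖V₂‖ ≤ 1 := norm_le_one_of_unitary h₂
  rw [R_second_diff_eq h₁ h₂ h₃ h₄]
  refine (fro_add₄_le _ _ _ _).trans ?_
  have t1 : fro ((V₁ - V₂ - V₃ + V₄) * X * V₁ᴴ) ≤ δ ^ 2 * fro X := by
    refine (fro_sandwich_le _ _ _).trans ?_
    have : ‖V₁ - V₂ - V₃ + V₄‖ ^ 2 * ‖V₁ᴴ‖ ^ 2 ≤ δ ^ 2 * 1 := by
      refine mul_le_mul (pow_le_pow_left₀ (norm_nonneg _) hs 2) ?_ (sq_nonneg _) (sq_nonneg _)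
      exact (sq_le_one_iff₀ (norm_nonneg _)).mpr hV₁
    nlinarith
  have t2 : fro ((V₃ - V₄) * X * (V₁ - V₃)ᴴ) ≤ δ ^ 2 * fro X := by
    refine (fro_sandwich_le _ _ _).trans ?_
    rw [Matrix.l2_opNorm_conjTranspose, ← mul_pow]
    exact mul_le_mul_of_nonneg_right (pow_le_pow_left₀ (by positivity) h13 2) hX
  have t3 : fro (V₂ * X * (V₁ - V₂ - V₃ + V₄)ᴴ) ≤ δ ^ 2 * fro X := by
    refine (fro_sandwich_le _ _ _).trans ?_
    rw [Matrix.l2_opNorm_conjTranspose]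
    have : ‖V₂‖ ^ 2 * ‖V₁ - V₂ - V₃ + V₄‖ ^ 2 ≤ 1 * δ ^ 2 := by
      refine mul_le_mul ((sq_le_one_iff₀ (norm_nonneg _)).mpr hV₂) (pow_le_pow_left₀ (norm_nonneg _) hs 2) (sq_nonneg _) zero_le_one
    nlinarith
  have t4 : fro ((V₂ - V₄) * X * (V₃ - V₄)ᴴ) ≤ δ ^ 2 * fro X := by
    refine (fro_sandwich_le _ _ _).trans ?_
    rw [Matrix.l2_opNorm_conjTranspose, ← mul_pow]
    exact mul_le_mul_of_nonneg_right (pow_le_pow_left₀ (by positivity) h24 2) hX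
  linarith

end SecondDiff

/-! ## §3 In components: the second difference of the adjoint component matrices -/

section Components

variable {c : ℝ} {Pc : Submodule ℝ (Matrix n n ℂ)} {e : ι → Matrix n n ℂ} (hF : CompFamily c Pc e)
variable {V₁ V₂ V₃ V₄ : Matrix n n ℂ}

include hF in
/-- **THE REAL COMPONENT BOUND** (pattern `AdjointCarrierWiring.adMat_real_bound`): for unitaries `V₁, …, V₄` as in `fro_R_second_diff_le` and a REAL coefficient vector `a`,
`Σ_k (Σ_i (adMat V₁ − adMat V₂ − adMat V₃ + adMat V₄)_{ki} a_i)² ≤ 16δ²·Σ_k a_k²` (Parseval on `Pc` for `X = Σ a_i e_i` and its image, which stays in `Pc`). [folklore] -/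
theorem adMat_second_diff_real_bound (h₁ : V₁ ∈ Matrix.unitaryGroup n ℂ) (h₂ : V₂ ∈ Matrix.unitaryGroup n ℂ) (h₃ : V₃ ∈ Matrix.unitaryGroup n ℂ)
    (h₄ : V₄ ∈ Matrix.unitaryGroup n ℂ) {δ : ℝ} (hs : ‖V₁ - V₂ - V₃ + V₄‖ ≤ δ) (h13 : ‖V₃ - V₄‖ * ‖V₁ - V₃‖ ≤ δ) (h24 : ‖V₂ - V₄‖ * ‖V₃ - V₄‖ ≤ δ)
    (a : ι → ℝ) :
    ∑ k, (∑ i, (adMat c e V₁ - adMat c e V₂ - adMat c e V₃ + adMat c e V₄) k i * a i) ^ 2 ≤ 16 * δ ^ 2 * ∑ k, a k ^ 2 := by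
  set X : Matrix n n ℂ := ∑ i, a i • e i with hXdef
  have hX : X ∈ Pc := Pc.sum_mem fun i _ => Pc.smul_mem _ (hF.mem i)
  set Y : Matrix n n ℂ := R V₁ X - R V₂ X - R V₃ X + R V₄ X with hYdef
  have hY : Y ∈ Pc := Pc.add_mem (Pc.sub_mem (Pc.sub_mem (hF.stable V₁ h₁ X hX) (hF.stable V₂ h₂ X hX)) (hF.stable V₃ h₃ X hX)) (hF.stable V₄ h₄ X hX)
  -- coordinates of `R V_j X`
  have hco : ∀ {u : Matrix n n ℂ} (k : ι), form c (e k) (R u X) = ∑ i, adMat c e u k i * a i := by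
    intro u k
    have h := coord_map (form c) Pc e hF.compl (Rₗ u) hX k
    rw [Rₗ_apply] at h
    rw [h]
    refine Finset.sum_congr rfl fun i _ => ?_
    rw [Rₗ_apply, adMat_apply, hXdef, form_combination e hF.orth a i]
  have hcoef : ∀ k, ∑ i, (adMat c e V₁ - adMat c e V₂ - adMat c e V₃ + adMat c e V₄) k i * a i = form c (e k) Y := by
    intro k
    rw [hYdef, map_add, map_sub, map_sub, hco, hco, hco, hco, ← Finset.sum_sub_distrib, ← Finset.sum_sub_distrib, ← Finset.sum_add_distrib]
    refine Finset.sum_congr rfl fun i _ => ?_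
    simp only [Matrix.add_apply, Matrix.sub_apply]
    ring
  have hPY : ∑ k, form c (e k) Y ^ 2 = form c Y Y := by
    simp_rw [sq]; exact parseval (form c) e (hF.compl Y hY) Y
  have hPX : ∑ k, form c (e k) X ^ 2 = form c X X := by
    simp_rw [sq]; exact parseval (form c) e (hF.compl X hX) X
  have hak2 : ∑ k, a k ^ 2 = ∑ k, form c (e k) X ^ 2 :=
    Finset.sum_congr rfl fun k _ => by rw [hXdef, form_combination e hF.orth a k]
  calc ∑ k, (∑ i, (adMat c e V₁ - adMat c e V₂ - adMat c e V₃ + adMat c e V₄) k i * a i) ^ 2 = ∑ k, form c (e k) Y ^ 2 :=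
        Finset.sum_congr rfl fun k _ => by rw [hcoef k]
    _ = c * fro Y := by rw [hPY, form_self_eq_fro (hF.herm Y hY)]
    _ ≤ c * (16 * δ ^ 2 * fro X) := mul_le_mul_of_nonneg_left (fro_R_second_diff_le h₁ h₂ h₃ h₄ hs h13 h24 X) hF.pos.le
    _ = 16 * δ ^ 2 * form c X X := by rw [form_self_eq_fro (hF.herm X hX)]; ring
    _ = 16 * δ ^ 2 * ∑ k, a k ^ 2 := by rw [← hPX, hak2]

include hF in
/-- **THE SECOND DIFFERENCE OF `Ad` IN THE `ℓ²`-OPERATOR NORM**: `‖Ad V₁ − Ad V₂ − Ad V₃ + Ad V₄‖ ≤ 4δ` (complexify `adMat_second_diff_real_bound` by real and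
imaginary parts, as in the β cell's `norm_cpx_adMat_sub_one_le`). [folklore] -/
theorem norm_cpx_adMat_second_diff_le (h₁ : V₁ ∈ Matrix.unitaryGroup n ℂ) (h₂ : V₂ ∈ Matrix.unitaryGroup n ℂ) (h₃ : V₃ ∈ Matrix.unitaryGroup n ℂ)
    (h₄ : V₄ ∈ Matrix.unitaryGroup n ℂ) {δ : ℝ} (hs : ‖V₁ - V₂ - V₃ + V₄‖ ≤ δ) (h13 : ‖V₃ - V₄‖ * ‖V₁ - V₃‖ ≤ δ) (h24 : ‖V₂ - V₄‖ * ‖V₃ - V₄‖ ≤ δ) :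
    ‖cpxHom (adMat c e V₁) - cpxHom (adMat c e V₂) - cpxHom (adMat c e V₃) + cpxHom (adMat c e V₄)‖ ≤ 4 * δ := by
  have hδ : 0 ≤ δ := (norm_nonneg _).trans hs
  set Mr : Matrix ι ι ℝ := adMat c e V₁ - adMat c e V₂ - adMat c e V₃ + adMat c e V₄ with hMr
  have hA : cpxHom (adMat c e V₁) - cpxHom (adMat c e V₂) - cpxHom (adMat c e V₃) + cpxHom (adMat c e V₄) = cpxHom Mr := by
    rw [hMr, map_add, map_sub, map_sub]
  rw [hA]
  refine norm_le_of_mulVec_le _ (by positivity) fun v => ?_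
  have hre : ∀ k, ((cpxHom Mr *ᵥ v) k).re = ∑ i, Mr k i * (v i).re := by
    intro k
    simp only [Matrix.mulVec, dotProduct, cpxHom_apply, Complex.re_sum, Complex.re_ofReal_mul]
  have him : ∀ k, ((cpxHom Mr *ᵥ v) k).im = ∑ i, Mr k i * (v i).im := by
    intro k
    simp only [Matrix.mulVec, dotProduct, cpxHom_apply, Complex.im_sum, Complex.im_ofReal_mul]
  have hsq : ‖(WithLp.toLp 2 (cpxHom Mr *ᵥ v) : EuclideanSpace ℂ ι)‖ ^ 2 =
      ∑ k, (∑ i, Mr k i * (v i).re) ^ 2 + ∑ k, (∑ i, Mr k i * (v i).im) ^ 2 := by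
    rw [EuclideanSpace.norm_sq_eq, ← Finset.sum_add_distrib]
    refine Finset.sum_congr rfl fun k _ => ?_
    rw [PiLp.toLp_apply, Complex.sq_norm, Complex.normSq_apply, hre, him]
    ring
  have hv : ‖(WithLp.toLp 2 v : EuclideanSpace ℂ ι)‖ ^ 2 = ∑ k, (v k).re ^ 2 + ∑ k, (v k).im ^ 2 := by
    rw [EuclideanSpace.norm_sq_eq, ← Finset.sum_add_distrib]
    refine Finset.sum_congr rfl fun k _ => ?_
    rw [PiLp.toLp_apply, Complex.sq_norm, Complex.normSq_apply]
    ring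
  have hb1 := adMat_second_diff_real_bound hF h₁ h₂ h₃ h₄ hs h13 h24 (fun i => (v i).re)
  have hb2 := adMat_second_diff_real_bound hF h₁ h₂ h₃ h₄ hs h13 h24 (fun i => (v i).im)
  have hsq_le : ‖(WithLp.toLp 2 (cpxHom Mr *ᵥ v) : EuclideanSpace ℂ ι)‖ ^ 2 ≤ (4 * δ * ‖(WithLp.toLp 2 v : EuclideanSpace ℂ ι)‖) ^ 2 := by
    rw [hsq, mul_pow, hv]
    nlinarith [hb1, hb2]
  exact (pow_le_pow_iff_left₀ (norm_nonneg _) (by positivity) two_ne_zero).mp hsq_le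

end Components

/-! ## §4 Along the tower: `RegularSites (Ad ∘ V)` from `RegularSites V`, and the END with ONE regularity binder -/

section Tower

variable (L : ℕ) [NeZero L] (M : Fin d → ℕ) [hM : ∀ μ, NeZero (M μ)]
variable {c : ℝ} {Pc : Submodule ℝ (Matrix n n ℂ)} {e : ι → Matrix n n ℂ} (hF : CompFamily c Pc e)
variable (V : (k : ℕ) → Fin d → Tor (fine (lev L k) M) → Matrix.unitaryGroup n ℂ) {α₁ β₁ β₂ : ℝ}

omit hM in
/-- first-difference letter, unscaled: `‖V_k(x + e_μ) − V_k(x)‖ ≤ β₁/c_k²`. [folklore] -/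
theorem norm_V_tau_sub_le (h : RegularSites L M (fun k ν x => (V k ν x : Matrix n n ℂ)) α₁ β₁ β₂) (k : ℕ) (ν μ : Fin d)
    (x : Tor (fine (lev L k) M)) : ‖(V k ν (x + unitVec _ μ) : Matrix n n ℂ) - (V k ν x : Matrix n n ℂ)‖ ≤ β₁ / ((lev L k : ℕ) : ℝ) ^ 2 :=
  norm_tau_sub_le_of_reg L M h.toRegularTransporters k ν μ (x, ν)

omit hM in
/-- second-difference letter, unscaled: `‖V_k(x + e_ρ + e_λ) − V_k(x + e_ρ) − V_k(x + e_λ) + V_k(x)‖ ≤ β₂/c_k³`. [folklore] -/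
theorem norm_V_second_diff_le (h : RegularSites L M (fun k ν x => (V k ν x : Matrix n n ℂ)) α₁ β₁ β₂) (k : ℕ) (ν lam ρ : Fin d)
    (x : Tor (fine (lev L k) M)) :
    ‖(V k ν (x + unitVec _ ρ + unitVec _ lam) : Matrix n n ℂ) - (V k ν (x + unitVec _ ρ) : Matrix n n ℂ)
        - (V k ν (x + unitVec _ lam) : Matrix n n ℂ) + (V k ν x : Matrix n n ℂ)‖ ≤ β₂ / ((lev L k : ℕ) : ℝ) ^ 3 := by
  have hℓ : (0 : ℝ) < (lev L k : ℕ) := lev_pos L k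
  have h1 := second_diff_letter_of_reg L M V h k ν lam ρ (x, ν)
  simp only [GaugeTermDecomposition.liftR, BlockPairingGeometry.tau] at h1
  rw [norm_smul, Complex.norm_natCast] at h1
  have e : (V k ν (x + unitVec _ ρ + unitVec _ lam) : Matrix n n ℂ) - (V k ν (x + unitVec _ ρ) : Matrix n n ℂ)
        - (V k ν (x + unitVec _ lam) : Matrix n n ℂ) + (V k ν x : Matrix n n ℂ)
      = (V k ν (x + unitVec _ ρ + unitVec _ lam) : Matrix n n ℂ) - (V k ν (x + unitVec _ lam) : Matrix n n ℂ)
        - (V k ν (x + unitVec _ ρ) : Matrix n n ℂ) + (V k ν x : Matrix n n ℂ) := by abel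
  rw [e, pow_succ, ← div_div, le_div_iff₀ hℓ, mul_comm]
  exact h1

omit hM in
/-- **`RegularSites (Ad ∘ V)` FROM `RegularSites V`**: size `2α₁`, lattice-Lipschitz `2β₁` (the β cell's `‖Ad g − Ad h‖ ≤ 2‖g − h‖`), second differences `4(β₂ + β₁²)`
(§3 with `δ = (β₂ + β₁²)/c_k³`).  The (3.35)+(3.36)-shape connection binder of every `Spine/NE2/` END is thereby a consequence of the same shapes ON THE GAUGE FIELD. [folklore] -/
theorem regularSites_adjointField [Nonempty n] (h : RegularSites L M (fun k ν x => (V k ν x : Matrix n n ℂ)) α₁ β₁ β₂) :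
    RegularSites L M (fun k ν x => adRep hF (V k ν x)) (2 * α₁) (2 * β₁) (4 * (β₂ + β₁ ^ 2)) where
  nonneg := ⟨by linarith [h.nonneg.1], by linarith [h.nonneg.2.1], by nlinarith [h.nonneg.2.2, sq_nonneg β₁]⟩
  size k ν i := by
    have hℓ : (0 : ℝ) ≤ (lev L k : ℕ) := (lev_pos L k).le
    have h1 := h.size k ν i
    rw [wT, norm_smul, Complex.norm_natCast] at h1 ⊢
    calc ((lev L k : ℕ) : ℝ) * ‖adRep hF (V k ν i.1) - 1‖ ≤ ((lev L k : ℕ) : ℝ) * (2 * ‖(V k ν i.1 : Matrix n n ℂ) - 1‖) :=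
          mul_le_mul_of_nonneg_left (by rw [← dist1_unitaryGroup]; exact norm_adRep_sub_one_le hF _) hℓ
      _ = 2 * (((lev L k : ℕ) : ℝ) * ‖(V k ν i.1 : Matrix n n ℂ) - 1‖) := by ring
      _ ≤ 2 * α₁ := by linarith
  lipschitz k ν lam i := by
    have hℓ : (0 : ℝ) ≤ (lev L k : ℕ) := (lev_pos L k).le
    have h1 := h.lipschitz k ν lam i
    rw [wT, wT, ← smul_sub, sub_sub_sub_cancel_right, norm_smul, Complex.norm_natCast] at h1 ⊢
    calc ((lev L k : ℕ) : ℝ) * ‖adRep hF (V k ν (tau (fine (lev L k) M) lam i).1) - adRep hF (V k ν i.1)‖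
        ≤ ((lev L k : ℕ) : ℝ) * (2 * ‖(V k ν (tau (fine (lev L k) M) lam i).1 : Matrix n n ℂ) - (V k ν i.1 : Matrix n n ℂ)‖) :=
          mul_le_mul_of_nonneg_left (norm_adRep_sub_adRep_le hF _ _) hℓ
      _ = 2 * (((lev L k : ℕ) : ℝ) * ‖(V k ν (tau (fine (lev L k) M) lam i).1 : Matrix n n ℂ) - (V k ν i.1 : Matrix n n ℂ)‖) := by ring
      _ ≤ 2 * β₁ / (lev L k : ℕ) := by rw [mul_div_assoc]; linarith
  lipschitz₂ k lam ν ρ i := by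
    have hℓ1 : (1 : ℝ) ≤ (lev L k : ℕ) := by exact_mod_cast one_le_lev' L k
    have hℓ : (0 : ℝ) < (lev L k : ℕ) := by linarith
    have hβ₁ := h.nonneg.2.1
    have hβ₂ := h.nonneg.2.2
    -- the four bond variables
    set x := i.1 with hx
    set U₁ : Matrix n n ℂ := (V k ν (x + unitVec _ ρ + unitVec _ lam) : Matrix n n ℂ) with hU₁
    set U₂ : Matrix n n ℂ := (V k ν (x + unitVec _ ρ) : Matrix n n ℂ) with hU₂
    set U₃ : Matrix n n ℂ := (V k ν (x + unitVec _ lam) : Matrix n n ℂ) with hU₃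
    set U₄ : Matrix n n ℂ := (V k ν x : Matrix n n ℂ) with hU₄
    set δ : ℝ := (β₂ + β₁ ^ 2) / ((lev L k : ℕ) : ℝ) ^ 3 with hδ
    have hs : ‖U₁ - U₂ - U₃ + U₄‖ ≤ δ := by
      refine (norm_V_second_diff_le L M V h k ν lam ρ x).trans ?_
      exact div_le_div_of_nonneg_right (by nlinarith [sq_nonneg β₁]) (by positivity)
    have hprod : β₁ / ((lev L k : ℕ) : ℝ) ^ 2 * (β₁ / ((lev L k : ℕ) : ℝ) ^ 2) ≤ δ := by
      rw [hδ, div_mul_div_comm, div_le_div_iff₀ (by positivity) (by positivity)]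
      have h6 : ((lev L k : ℕ) : ℝ) ^ 3 ≤ ((lev L k : ℕ) : ℝ) ^ 2 * ((lev L k : ℕ) : ℝ) ^ 2 := by
        rw [← pow_add]; exact pow_le_pow_right₀ hℓ1 (by norm_num)
      nlinarith [sq_nonneg β₁, mul_nonneg (mul_nonneg hβ₁ hβ₁) (by positivity : (0 : ℝ) ≤ ((lev L k : ℕ) : ℝ) ^ 3),
        mul_nonneg hβ₂ (by positivity : (0 : ℝ) ≤ ((lev L k : ℕ) : ℝ) ^ 2 * ((lev L k : ℕ) : ℝ) ^ 2)]
    have h13 : ‖U₃ - U₄‖ * ‖U₁ - U₃‖ ≤ δ := by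
      refine le_trans (mul_le_mul (norm_V_tau_sub_le L M V h k ν lam x) ?_ (norm_nonneg _) (by positivity)) hprod
      have := norm_V_tau_sub_le L M V h k ν ρ (x + unitVec _ lam)
      rwa [add_right_comm] at this
    have h24 : ‖U₂ - U₄‖ * ‖U₃ - U₄‖ ≤ δ :=
      le_trans (mul_le_mul (norm_V_tau_sub_le L M V h k ν ρ x) (norm_V_tau_sub_le L M V h k ν lam x) (norm_nonneg _) (by positivity)) hprod
    have hmain := norm_cpx_adMat_second_diff_le hF (V k ν (x + unitVec _ ρ + unitVec _ lam)).2 (V k ν (x + unitVec _ ρ)).2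
      (V k ν (x + unitVec _ lam)).2 (V k ν x).2 hs h13 h24
    -- the difference of the quotients is `c_k² •` the second difference of `Ad`
    have hD : DqT L M (fun k ν x => adRep hF (V k ν x)) lam k ν (tau (fine (lev L k) M) ρ i) - DqT L M (fun k ν x => adRep hF (V k ν x)) lam k ν i
        = (((lev L k : ℕ) : ℂ) * ((lev L k : ℕ) : ℂ)) • (cpxHom (adMat c e U₁) - cpxHom (adMat c e U₂) - cpxHom (adMat c e U₃) + cpxHom (adMat c e U₄)) := by
      simp only [DqT, wT, adRep_apply, BlockPairingGeometry.tau, hU₁, hU₂, hU₃, hU₄, hx]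
      module
    rw [hD, norm_smul, norm_mul, Complex.norm_natCast]
    calc ((lev L k : ℕ) : ℝ) * ((lev L k : ℕ) : ℝ) * ‖cpxHom (adMat c e U₁) - cpxHom (adMat c e U₂) - cpxHom (adMat c e U₃) + cpxHom (adMat c e U₄)‖
        ≤ ((lev L k : ℕ) : ℝ) * ((lev L k : ℕ) : ℝ) * (4 * δ) := mul_le_mul_of_nonneg_left hmain (by positivity)
      _ = 4 * (β₂ + β₁ ^ 2) / (lev L k : ℕ) := by rw [hδ]; field_simp

variable (a : ℝ) (ha : 0 < a)

include ha in
/-- **RATE END FOR PRINT'S (3.26) SHAPE WITH ONE REGULARITY BINDER ON THE DATA.**  `DeltaPrimeBondData.balaban326_rate_of_bondRegular` with the connection binder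
`RegularSites (Ad ∘ V)` DISCHARGED by `regularSites_adjointField` (`α = 2α₁`, `β = 2β₁`, `β₂′ = 4(β₂ + β₁²)`): the hypotheses are `hF` (component family), `2 ≤ L`, `1 ≤ d`,
the DATA `V` (a tower of `U(N)` lattice gauge fields), **`hregV : RegularSites L M V α₁ β₁ β₂`** (the (3.35)+(3.36)-shape letters: size / lattice-Lipschitz / second
differences of the bond variables), node NE3's `LocalRate` on `regClass₂ (Ad ∘ V)` BY NAME (OPEN), the NE3-type block-parent consistency (Fc) of the field strength,
`2α₁, 2β₁ ≤ η ≤ etaStar ι d a a′`, and ONE threshold — NOTHING ELSE.  Conclusion: the tower-limit rate `L^{−k}` for the inverse of print's (3.26)-shape operator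
`[principal part at R = Ad V] + Q(R)* a Q(R) + Δ′(V)` ((3.10)'s whole `Δ′`; the model's covariant averaging in place of [B7]'s — residual r2).  Model level; that Bałaban's
minimiser is this regular is [B9] (3.35)–(3.36) + node NE3; NE2 (U1a) NOT proved by this. [cite: Balaban1985BackgroundPropagators, (3.10) p.392, (3.26) p.395,
(3.35)–(3.36) p.396 (shapes)] [folklore] -/
theorem balaban326_rate_of_regularGaugeField [Nonempty n] [Nonempty ι] (hL : 2 ≤ L) (hd : 1 ≤ d)
    (hregV : RegularSites L M (fun k ν x => (V k ν x : Matrix n n ℂ)) α₁ β₁ β₂) {C : ℝ} (hC : 0 ≤ C)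
    (hNE3₂ : LocalRate (bgReadings L M (regClass₂ L M (fun k ν x => adRep hF (V k ν x)))) C ((L : ℝ)⁻¹)) {a' : ℝ} (ha' : 0 < a')
    {η : ℝ} (hαη : 2 * α₁ ≤ η) (hβη : 2 * β₁ ≤ η) (hη : η ≤ etaStar ι d a a') {ρ : ℝ} (hρ : 0 ≤ ρ)
    (hFc : ∀ k μ ν (y : Tor (fine (lev L (k + 1)) M)), ‖Fstr (fine (lev L (k + 1)) M) (lev L (k + 1)) (fun ν x => (V (k + 1) ν x : Matrix n n ℂ)) μ ν y
      - Fstr (fine (lev L k) M) (lev L k) (fun ν x => (V k ν x : Matrix n n ℂ)) μ ν (par (lev L k) L M y)‖ ≤ ρ / (lev L k : ℕ))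
    (hthr : (kappaBs ι d a (2 * α₁) (2 * β₁) (a * (epsR ι d (2 * α₁) * (2 + epsR ι d (2 * α₁)) * Cst d a)) (kappa4F d a a' (2 * α₁) (2 * β₁))
      + (d : ℝ) ^ 2 * ((2 * (2 * β₁) + 2 * (2 * α₁) ^ 2) * Cst d a))
      + kappaDP d a (‖symL c e‖ * (2 * β₁ + 2 * α₁ ^ 2) ^ 2 / 2) (‖brkL c e‖ * (2 * β₁ + 2 * α₁ ^ 2)) < 1) :
    TowerLimitRate (fun k => Qlev L M k ⊗ₖ (1 : Matrix ι ι ℂ)) ((L : ℝ) ^ d)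
      (fun k => (principalB9 (fine (lev L k) M) ((lev L k : ℕ) : ℂ) (fun ν x => adRep hF (V k ν x))
          (projP (fine (lev L k) M) (Gop L M (fun k ν x => adRep hF (V k ν x)) (QuT L M ι (siteT L M (fun k ν x => adRep hF (V k ν x)))) a' k)
            (QuT L M ι (siteT L M (fun k ν x => adRep hF (V k ν x))) k))
        + (a : ℂ) • (((((lev L k : ℕ) : ℂ) ^ d) • (QcovLev L M (liftR L M (fun k ν x => adRep hF (V k ν x))) k)ᴴ)
            * QcovLev L M (liftR L M (fun k ν x => adRep hF (V k ν x))) k)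
        + deltaPrime (fine (lev L k) M) (lev L k) c e (fun ν x => (V k ν x : Matrix n n ℂ)))⁻¹)
      (Cpert ((kappaBs ι d a (2 * α₁) (2 * β₁) (a * (epsR ι d (2 * α₁) * (2 + epsR ι d (2 * α₁)) * Cst d a)) (kappa4F d a a' (2 * α₁) (2 * β₁))
          + (d : ℝ) ^ 2 * ((2 * (2 * β₁) + 2 * (2 * α₁) ^ 2) * Cst d a))
          + kappaDP d a (‖symL c e‖ * (2 * β₁ + 2 * α₁ ^ 2) ^ 2 / 2) (‖brkL c e‖ * (2 * β₁ + 2 * α₁ ^ 2))) (2 * d * Cst d a) (CJ d a)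
        ((C2Bs ι d L a (2 * α₁) (2 * β₁) (betaNE3 ι C + 4 * (β₂ + β₁ ^ 2))
            (a * C2gram (Cst d a) 1 (epsR ι d (2 * α₁)) (2 * d * Cst d a) (CJ d a) (Cst d a)
              (CdeltaR ι d a (2 * α₁) (theta0 d (2 * α₁) (betaNE3 ι (betaNE3 ι C + 4 * (β₂ + β₁ ^ 2))))))
            (C4F ι d L a a' (2 * α₁) (2 * β₁) (betaNE3 ι C + 4 * (β₂ + β₁ ^ 2)))
          + (d : ℝ) ^ 2 * (Cst d a * ((2 * (2 * β₁) + 2 * (2 * α₁) ^ 2) * (2 * Cst d a)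
              + (2 * (betaNE3 ι C + 4 * (β₂ + β₁ ^ 2)) + 4 * (2 * α₁) * (betaNE3 ι C + 2 * β₁)) * Cst d a)))
          + CDP d a (‖symL c e‖ * (2 * β₁ + 2 * α₁ ^ 2) ^ 2 / 2)
              (‖symL c e‖ * (2 * β₁ + 2 * α₁ ^ 2) ^ 2 / 2 * (4 * α₁)
                + (‖symL c e‖ * (2 * β₁ + 2 * α₁ ^ 2) ^ 2 + ‖symL c e‖ * (2 * β₁ + 2 * α₁ ^ 2) ^ 2)
                + ‖symL c e‖ * (2 * β₁ + 2 * α₁ ^ 2) ^ 2 / 2 * (4 * α₁))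
              (‖brkL c e‖ * (2 * β₁ + 2 * α₁ ^ 2))
              (‖brkL c e‖ * (2 * β₁ + 2 * α₁ ^ 2) * (4 * α₁)
                + (‖brkL c e‖ * ρ + ‖brkL c e‖ * ((2 * β₂ + 4 * α₁ * β₁) + 2 * β₁ * (2 * β₁ + 2 * α₁ ^ 2)))
                + ‖brkL c e‖ * (2 * β₁ + 2 * α₁ ^ 2) * (4 * α₁)))
        0 1) ((L : ℝ)⁻¹) :=
  balaban326_rate_of_bondRegular L M a ha hF hL hd V hregV (regularSites_adjointField L M hF V hregV) hC hNE3₂ ha' hαη hβη hη hρ hFc hthr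

end Tower

end Summit.QuantumFields.BalabanUV.T4Continuum.NE2.AdjointFieldRegularity

end
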